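import Mathlib.MeasureTheory.Integral.IntervalIntegral.AbsolutelyContinuousFun
import HarnessLib

/-!
# A non-constant absolutely continuous function has non-zero derivative on a set of positive measure

Topic `Literature/Analysis/Calculus`. This is the measure-theoretic half of the last step
(§13.4, "Arranging for a constant Klein–Gordon mass", pp. 58–59 of arXiv:1510.08025)
of O. Chodosh, Y. Shlapentokh-Rothman, *Time-periodic Einstein–Klein–Gordon bifurcations of
Kerr*, Comm. Math. Phys. 356 (2017) 1155–1250, the other half being Halkin's implicit function
theorem
(CSR Thm. 15.1, `Literature/Analysis/Calculus/LipschitzImplicitFunction.lean`). In the printed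
proof of CSR Thm. 1.1 from Thm. 13.1: "Because `a ↦ μ²(a, M(a), 0)` is Lipschitz, and thus
absolutely continuous, it is differentiable almost everywhere, and the fundamental theorem of
calculus holds. In particular, it follows from [`lim_{a→0} μ²(a, M(a), 0) = 0`, while
`μ²(a, M(a), 0) > ω² > 0` for `a > 0`] that we can find an set of positive measure
`𝔇 ⊂ (0, ∞)` so that `a ∈ 𝔇` implies that `d/da (μ²(a, M(a), 0))` exists and is non-zero"
(p. 59). The present file isolates the underlying real-analysis fact, a node of the
decomposition of the barrier fact `Literature.Barriers.FinalStateConjecture.HairyKerrBifurcation`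
(CSR Thm. 1.1) recorded in `Literature/Barriers/FinalStateConjecture/HairyKerrBifurcation.lean`:

* `Literature.Analysis.Calculus.measure_pos_deriv_ne_zero_of_absolutelyContinuousOnInterval`: if `f : ℝ → ℝ` is
  absolutely continuous on `[a, b]` and `f a ≠ f b`, then `{x ∈ (a, b) | f` differentiable at `x`,
  `f'(x) ≠ 0}` has positive Lebesgue measure (contrapositive of Mathlib's
  `AbsolutelyContinuousOnInterval.const_of_ae_hasDerivAt_zero` — absolutely continuous with
  a.e. vanishing derivative implies constant — combined with a.e. differentiability,
  `AbsolutelyContinuousOnInterval.ae_differentiableAt`);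
* `Literature.Analysis.Calculus.measure_pos_deriv_ne_zero_of_lipschitzOnWith`,
  `Literature.Analysis.Calculus.exists_deriv_ne_zero_of_lipschitzOnWith`: the Lipschitz case
  (`LipschitzOnWith.absolutelyContinuousOnInterval`), and the existence of one such point;
* `Literature.Analysis.Calculus.exists_measure_pos_deriv_ne_zero_of_tendsto`: the printed shape — `g` Lipschitz on
  `(0, A]`, `g(a) → 0` as `a → 0⁺`, `g(A) > 0` ⇒ a positive-measure set `𝔇 ⊂ (0, ∞)` of
  points where `g` is differentiable with non-zero derivative.

## References

* O. Chodosh, Y. Shlapentokh-Rothman, *Time-periodic Einstein–Klein–Gordon bifurcations of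
  Kerr*, Comm. Math. Phys. 356 (2017) 1155–1250, arXiv:1510.08025: §13.4, proof of Thm. 1.1
  (pp. 58–59). [ChodoshShlapentokhrothman2017]
* Standard real analysis (Lebesgue's differentiation theorem for absolutely continuous
  functions): e.g. Rudin, *Real and Complex Analysis*, Thm. 7.20. [folklore]
-/

open Set Filter MeasureTheory Topology

noncomputable section

namespace Literature.Analysis.Calculus

/-- **A non-constant absolutely continuous function has non-zero derivative on a set of positive
measure.** If `f : ℝ → ℝ` is absolutely continuous on `uIcc a b` and `f a ≠ f b`, then the
set of `x` strictly between `a` and `b` at which `f` is differentiable with `deriv f x ≠ 0` has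
positive Lebesgue measure. (Contrapositive of: absolutely continuous with a.e. zero derivative
implies constant; Rudin, *Real and Complex Analysis*, Thm. 7.20; the use made of it by
Chodosh–Shlapentokh-Rothman, CMP 356 (2017), §13.4, p. 59.) [folklore] -/
theorem measure_pos_deriv_ne_zero_of_absolutelyContinuousOnInterval {f : ℝ → ℝ} {a b : ℝ}
    (hf : AbsolutelyContinuousOnInterval f a b) (hne : f a ≠ f b) :
    0 < volume {x ∈ uIoo a b | DifferentiableAt ℝ f x ∧ deriv f x ≠ 0} := by
  rw [pos_iff_ne_zero]
  intro h0
  rw [measure_eq_zero_iff_ae_notMem] at h0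
  -- a.e. on `uIcc a b`, `f` has derivative `0`
  have hderiv : ∀ᵐ x, x ∈ uIcc a b → HasDerivAt f 0 x := by
    have hend : ∀ᵐ x ∂(volume : Measure ℝ), x ∉ ({a, b} : Set ℝ) :=
      measure_eq_zero_iff_ae_notMem.mp ((toFinite _).measure_zero _)
    filter_upwards [h0, hf.ae_differentiableAt, hend] with x hx hdiff hxe hxab
    have hxo : x ∈ uIoo a b := by
      simp only [mem_insert_iff, mem_singleton_iff, not_or] at hxe
      rcases le_total a b with hab | hab
      · rw [uIcc_of_le hab] at hxab
        rw [uIoo_of_le hab]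
        exact ⟨lt_of_le_of_ne hxab.1 (Ne.symm hxe.1), lt_of_le_of_ne hxab.2 hxe.2⟩
      · rw [uIcc_of_ge hab] at hxab
        rw [uIoo_of_ge hab]
        exact ⟨lt_of_le_of_ne hxab.1 (Ne.symm hxe.2), lt_of_le_of_ne hxab.2 hxe.1⟩
    have hd : DifferentiableAt ℝ f x := hdiff hxab
    have h0' : deriv f x = 0 := by
      by_contra hne0
      exact hx ⟨hxo, hd, hne0⟩
    simpa [h0'] using hd.hasDerivAt
  obtain ⟨C, hC⟩ := hf.const_of_ae_hasDerivAt_zero hderiv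
  exact hne ((hC a left_mem_uIcc).trans (hC b right_mem_uIcc).symm)

/-- The Lipschitz case: if `f` is Lipschitz on `uIcc a b` and `f a ≠ f b`, then
`{x ∈ uIoo a b | f differentiable at x, deriv f x ≠ 0}` has positive Lebesgue measure
("Lipschitz, and thus absolutely continuous, [hence] differentiable almost everywhere, and the
fundamental theorem of calculus holds", Chodosh–Shlapentokh-Rothman, CMP 356 (2017), §13.4,
p. 59). [folklore] -/
theorem measure_pos_deriv_ne_zero_of_lipschitzOnWith {f : ℝ → ℝ} {a b : ℝ} {K : NNReal}
    (hf : LipschitzOnWith K f (uIcc a b)) (hne : f a ≠ f b) :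
    0 < volume {x ∈ uIoo a b | DifferentiableAt ℝ f x ∧ deriv f x ≠ 0} :=
  measure_pos_deriv_ne_zero_of_absolutelyContinuousOnInterval hf.absolutelyContinuousOnInterval hne

/-- In particular a Lipschitz `f` with `f a ≠ f b` is differentiable with non-zero derivative at
some point strictly between `a` and `b`. [folklore] -/
theorem exists_deriv_ne_zero_of_lipschitzOnWith {f : ℝ → ℝ} {a b : ℝ} {K : NNReal}
    (hf : LipschitzOnWith K f (uIcc a b)) (hne : f a ≠ f b) :
    ∃ x ∈ uIoo a b, DifferentiableAt ℝ f x ∧ deriv f x ≠ 0 := by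
  obtain ⟨x, hx⟩ :=
    nonempty_of_measure_ne_zero (measure_pos_deriv_ne_zero_of_lipschitzOnWith hf hne).ne'
  exact ⟨x, hx.1, hx.2⟩

/-- **The printed shape (Chodosh–Shlapentokh-Rothman, §13.4).** Let `g : ℝ → ℝ` be Lipschitz
on `(0, A]` with `g(a) → 0` as `a → 0⁺` and `g(A) > 0` (in CSR: `g(a) = μ²(a, M(a), 0)`, the
Klein–Gordon mass of the linear hair on the Kerr exterior with `M(a)² − a² = γ²` fixed, which
is Lipschitz in `a` by their Lemma 13.4.1, tends to `0` as `a → 0` by the displayed limit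
opening the proof of Thm. 1.1 — "which essentially encodes the fact that there is no
superradiance on Schwarzschild" — and exceeds `ω² > 0` for `a > 0`). Then there is a set
`𝔇 ⊂ (0, ∞)` of positive Lebesgue measure at every point of which `g` is differentiable with
non-zero derivative. Chodosh–Shlapentokh-Rothman, CMP 356 (2017), proof of Thm. 1.1, §13.4
(pp. 58–59 of arXiv:1510.08025). [cite: ChodoshShlapentokhrothman2017, §13.4 (proof of Thm. 1.1)] -/
theorem exists_measure_pos_deriv_ne_zero_of_tendsto {g : ℝ → ℝ} {A : ℝ} {K : NNReal}
    (hA : 0 < A) (hg : LipschitzOnWith K g (Ioc 0 A))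
    (h0 : Tendsto g (𝓝[>] 0) (𝓝 0)) (hgA : 0 < g A) :
    ∃ 𝔇 : Set ℝ, 𝔇 ⊆ Ioi 0 ∧ 0 < volume 𝔇 ∧
      ∀ a ∈ 𝔇, DifferentiableAt ℝ g a ∧ deriv g a ≠ 0 := by
  -- pick `a₁ ∈ (0, A)` with `g a₁ < g A`
  have hev : ∀ᶠ a in 𝓝[>] (0 : ℝ), g a < g A ∧ a ∈ Ioo 0 A := by
    refine (h0.eventually (gt_mem_nhds hgA)).and ?_
    exact Ioo_mem_nhdsGT hA
  obtain ⟨a₁, hga₁, ha₁⟩ := hev.exists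
  have hsub : uIcc a₁ A ⊆ Ioc 0 A := by
    rw [uIcc_of_le ha₁.2.le]
    exact fun x hx ↦ ⟨ha₁.1.trans_le hx.1, hx.2⟩
  refine ⟨{x ∈ uIoo a₁ A | DifferentiableAt ℝ g x ∧ deriv g x ≠ 0}, fun x hx ↦ ?_,
    measure_pos_deriv_ne_zero_of_lipschitzOnWith (hg.mono hsub) hga₁.ne, fun a ha ↦ ha.2⟩
  have hx1 : x ∈ uIoo a₁ A := hx.1
  rw [uIoo_of_le ha₁.2.le] at hx1
  exact ha₁.1.trans hx1.1

end Literature.Analysis.Calculus
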